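import Literature.Algebra.EuclideanLattices.RegevRoutineDCP
import Literature.Computability.QuantumComplexity.CWrapPost
import Literature.Computability.Complexity.SplitOnesBricks
import HarnessLib

/-!
# Regev's per-copy routine as a circuit family, VIII: parsing the data words in polynomial time

Eighth file of the circuit-level construction towards the discharge of
`Literature.Algebra.EuclideanLattices.usvp_of_dihedralCoset` (O. Regev, *Quantum computation and
lattice problems*, SIAM J. Comput. 33 (2004), Thm. 1.1; the routine of the proof of Lemma 3.12,
p. 14). The two garbage-free blocks `W`, `V` of the routine receive the data words
`wordW = 1^L 0 · ix · 1^L 0 · ta · x · g · Z` and `wordV = 1^L 0 · ta · x · g · Z · 0^{NNW−n0W} · res`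
(file V); here they are taken apart by total polynomial-time string functions of the tree's brick
algebra (`BrickAlgebra.lean`, `PlumbingBricks.lean`, `SplitOnesBricks.lean`, `FoldBricks.lean`),
so that concrete block functions can be written as "parse, then compute":

* `ellPoly`, `sigPoly`, `zetPoly`, `n0WPoly`, `padVPoly` — the zone sizes as polynomials of `L`;
* **`parseW`** with `parseW_wordW`: on `wordW` it returns the record
  `⟨1^L, ⟨ix, ⟨ta, ⟨x, ⟨g, 1^k⟩⟩⟩⟩⟩` (`k` = the register number, read off the unary counter);
  `parseW_mem_FP`;
* `strideF c` (`strideF_apply`) — the bits of a string at the positions `A₁ j + c`, by a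
  concatenation fold of `bitAtFn`; with the read-out profile of a garbage-free block
  (`CWrap.outBit_symTrue_eq`, `CWrap.outBit_none_eq`) the result wires of `W` inside `wordV`
  give back the OUTPUT WORD of `W` (`outWordF`, `outWordF_res`);
* **`parseV`** with `parseV_wordV`: on `wordV` it returns `⟨1^L, ⟨ta, ⟨x, ⟨g, ⟨1^k, fW (wordW …)⟩⟩⟩⟩⟩`
  — the second block sees the first block's output word —; `parseV_mem_FP`.

No named fact is introduced.

## References

* O. Regev, *Quantum computation and lattice problems*, SIAM J. Comput. 33 (2004) 738–760, proof
  of Lemma 3.12 (p. 14) [Regev2004].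
* C. H. Bennett, *Logical reversibility of computation*, IBM J. Res. Develop. 17 (1973), §2
  (the erasing stage recomputes from the kept data and the copied result) [Bennett1973].
* S. Arora, B. Barak, *Computational Complexity: A Modern Approach*, CUP 2009, §1.3 (polynomial
  time is closed under composition and bounded loops) [AroraBarak2009].
-/

noncomputable section

namespace Literature.Algebra.EuclideanLattices

namespace RegevRoutine

open _root_.Computability Polynomial Literature.Computability.Complexity Literature.Computability.Complexity.Brick Plumb
  Literature.Computability.QuantumComplexity Turing RevSim RevClean

/-! ### The size polynomials of a parameter set -/

/-- The three polynomials the parsers need (register-count bound, `ix` field, guess zone): the part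
of `Params` that is fixed before the block functions are. [folklore] -/
structure Sizes where
  /-- bound of the number of registers, in terms of `ℓ` -/
  pr : Polynomial ℕ
  /-- size of the `ix` field -/
  pkap : Polynomial ℕ
  /-- size of the guess zone -/
  pgam : Polynomial ℕ

/-- The size polynomials of a parameter set. [folklore] -/
def Params.sizes (P : Params) : Sizes := ⟨P.pr, P.pkap, P.pgam⟩

variable (S : Sizes)

/-! ### Sizes as polynomials of the input length -/

/-- `ell L = L(4L+1)+1` as a polynomial. [folklore] -/
def ellPoly : Polynomial ℕ := X * (C 4 * X + 1) + 1

/-- `sig L = ell L + 1` as a polynomial. [folklore] -/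
def sigPoly : Polynomial ℕ := ellPoly + 1

/-- `zet L = rmax L + 1` as a polynomial. [folklore] -/
def zetPoly : Polynomial ℕ := S.pr.comp ellPoly + 2

/-- `n0W L` as a polynomial. [folklore] -/
def n0WPoly : Polynomial ℕ := (X + 1) + S.pkap + (X + 1) + sigPoly + X + S.pgam + zetPoly S

/-- The distance from the counter zone to the result wires of `W` inside `wordV`:
`zet L + (NNW L − n0W L)`, as a polynomial (for a first block with machine `M` and exponent `e`). [folklore] -/
def padVPoly (e : ℕ) (M : TM2ComputableAux Bool Bool) : Polynomial ℕ := zetPoly S + (ancNPoly M.tm e).comp (n0WPoly S)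

variable {S} {P : Params}

/-- Value of `ellPoly`. [folklore] -/
@[simp] theorem eval_ellPoly (L : ℕ) : ellPoly.eval L = ell L := by
  simp [ellPoly, ell]

/-- Value of `sigPoly`. [folklore] -/
@[simp] theorem eval_sigPoly (L : ℕ) : sigPoly.eval L = sig L := by
  simp [sigPoly, sig, slotW]

/-- Value of `zetPoly`. [folklore] -/
@[simp] theorem eval_zetPoly (L : ℕ) : (zetPoly P.sizes).eval L = zet P L := by
  simp [zetPoly, zet, rmax, eval_comp, Params.sizes]

/-- Value of `pkap`. [folklore] -/
@[simp] theorem eval_sizes_pkap (L : ℕ) : P.sizes.pkap.eval L = kap P L := rfl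

/-- Value of `pgam`. [folklore] -/
@[simp] theorem eval_sizes_pgam (L : ℕ) : P.sizes.pgam.eval L = gam P L := rfl

/-- Value of `n0WPoly`. [folklore] -/
@[simp] theorem eval_n0WPoly (L : ℕ) : (n0WPoly P.sizes).eval L = n0W P L := by
  simp [n0WPoly, n0W]

/-- Value of `padVPoly`. [folklore] -/
theorem eval_padVPoly (L : ℕ) : (padVPoly P.sizes P.eW P.MW).eval L = zet P L + (NNW P L - n0W P L) := by
  have : NNW P L = n0W P L + ancN P.MW.tm P.eW (n0W P L) := rfl
  simp [padVPoly, eval_comp, this]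

/-! ### The shape of the data words -/

section Shape

variable {L : ℕ} (x : List Bool) (g ixc tac : ℕ → Bool) (k : ℕ)

/-- The unary counter word of register `k ≤ rmax` is `1^k 0 0^{zet−k−1}`. [folklore] -/
theorem counterWord_eq (hk : k ≤ rmax P L) : counterWord P L k = ones k ++ false :: List.replicate (zet P L - k - 1) false := by
  have hz : zet P L = k + 1 + (zet P L - k - 1) := by unfold zet; omega
  unfold counterWord
  apply List.ext_getElem
  · simp; omega
  · intro i h1 h2
    rw [List.getElem_ofFn]
    by_cases hi : i < k
    · rw [List.getElem_append_left (by simpa using hi)]; simp [hi, ones]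
    · rw [List.getElem_append_right (by simpa using hi)]
      simp only [ones, List.length_replicate]
      rcases Nat.eq_or_lt_of_le (not_lt.1 hi) with h | h
      · subst h; simp
      · rw [List.getElem_cons]
        rw [dif_neg (by omega)]
        simp [not_lt.2 (le_of_lt h)]

/-- `List.ofFn` of `x.getD` over `Fin |x|` is `x` (a twin of `Complexity.ofFn_getD_self` of
`WindowLemmas.lean`, which is not in the import closure here). [folklore] -/
theorem ofFn_getD (x : List Bool) : (List.ofFn fun t : Fin x.length => x.getD t false) = x := by
  apply List.ext_getElem (by simp)
  intro i h1 h2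
  rw [List.getElem_ofFn, List.getD_eq_getElem _ _ h2]

/-- **The shape of `wordW`.** [folklore] -/
theorem wordW_shape (hx : x.length = L) (hk : k ≤ rmax P L) :
    wordW P L x g ixc tac k = ones L ++ false :: (List.ofFn (fun t : Fin (kap P L) => ixc t) ++
      (ones L ++ false :: (List.ofFn (fun t : Fin (sig L) => tac t) ++ (x ++ (List.ofFn (fun t : Fin (gam P L) => g t) ++
        (ones k ++ false :: List.replicate (zet P L - k - 1) false)))))) := by
  subst hx
  rw [wordW, counterWord_eq k hk, ofFn_getD, unaryU]
  simp [ones, List.append_assoc]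

/-- **The shape of `wordV`.** [folklore] -/
theorem wordV_shape (hx : x.length = L) (hk : k ≤ rmax P L) :
    wordV P L x g ixc tac k = ones L ++ false :: (List.ofFn (fun t : Fin (sig L) => tac t) ++ (x ++ (List.ofFn (fun t : Fin (gam P L) => g t) ++
      (ones k ++ false :: (List.replicate (zet P L - k - 1 + (NNW P L - n0W P L)) false ++
        List.ofFn (fun t : Fin (copyW P L) => readOut P.eW P.MW (n0W P L) (P.fW (wordW P L x g ixc tac k)) (NNW P L + t))))))) := by
  have e : (List.ofFn fun _ : Fin (NNW P L - n0W P L) => false) = List.replicate (NNW P L - n0W P L) false := by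
    apply List.ext_getElem (by simp); intro i h1 h2; simp
  conv_lhs => rw [wordV, counterWord_eq k hk, unaryU, e]
  subst hx
  rw [ofFn_getD]
  simp [ones, List.append_assoc]

end Shape

/-! ### Parsing `wordW` -/

section ParseW

variable (S)

/-- `1^{kap L}` from the leading `1^L`. [folklore] -/
def kapUF : List Bool → List Bool := polyFn S.pkap ∘ onesPrefixFn
/-- `1^{sig L}` from the leading `1^L`. [folklore] -/
def sigUF : List Bool → List Bool := polyFn sigPoly ∘ onesPrefixFn
/-- `1^{gam L}` from the leading `1^L`. [folklore] -/
def gamUF : List Bool → List Bool := polyFn S.pgam ∘ onesPrefixFn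
/-- `wordW` with `U` and `ix` removed: `1^L 0 · ta · x · g · Z`. [folklore] -/
def rest2F : List Bool → List Bool := dropFn ∘ fanoutFn (kapUF S) afterZeroFn
/-- `ta · x · g · Z`. [folklore] -/
def rest3F : List Bool → List Bool := afterZeroFn ∘ rest2F S
/-- `x · g · Z`. [folklore] -/
def rest4F : List Bool → List Bool := dropFn ∘ fanoutFn sigUF (rest3F S)
/-- `g · Z`. [folklore] -/
def rest5F : List Bool → List Bool := dropFn ∘ fanoutFn onesPrefixFn (rest4F S)
/-- `Z`. [folklore] -/
def rest6F : List Bool → List Bool := dropFn ∘ fanoutFn (gamUF S) (rest5F S)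

/-- **The parser of `wordW`**: `⟨1^L, ⟨ix, ⟨ta, ⟨x, ⟨g, 1^k⟩⟩⟩⟩⟩`. [cite: Regev2004, Lemma 3.12 (proof, p. 14: the data of the routine)] -/
def parseW : List Bool → List Bool :=
  fanoutFn onesPrefixFn (fanoutFn (takeFn ∘ fanoutFn (kapUF S) afterZeroFn) (fanoutFn (takeFn ∘ fanoutFn sigUF (rest3F S))
    (fanoutFn (takeFn ∘ fanoutFn onesPrefixFn (rest4F S)) (fanoutFn (takeFn ∘ fanoutFn (gamUF S) (rest5F S)) (onesPrefixFn ∘ rest6F S)))))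

variable {S}

/-- `parseW ∈ FP`. [cite: AroraBarak2009, §1.3] -/
theorem parseW_mem_FP : parseW S ∈ FP := by
  have h1 : kapUF S ∈ FP := comp_mem_FP (polyFn_mem_FP _) onesPrefixFn_mem_FP
  have h2 : sigUF ∈ FP := comp_mem_FP (polyFn_mem_FP _) onesPrefixFn_mem_FP
  have h3 : gamUF S ∈ FP := comp_mem_FP (polyFn_mem_FP _) onesPrefixFn_mem_FP
  have r2 : rest2F S ∈ FP := comp_mem_FP dropFn_mem_FP (fanoutFn_mem_FP h1 afterZeroFn_mem_FP)
  have r3 : rest3F S ∈ FP := comp_mem_FP afterZeroFn_mem_FP r2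
  have r4 : rest4F S ∈ FP := comp_mem_FP dropFn_mem_FP (fanoutFn_mem_FP h2 r3)
  have r5 : rest5F S ∈ FP := comp_mem_FP dropFn_mem_FP (fanoutFn_mem_FP onesPrefixFn_mem_FP r4)
  have r6 : rest6F S ∈ FP := comp_mem_FP dropFn_mem_FP (fanoutFn_mem_FP h3 r5)
  exact fanoutFn_mem_FP onesPrefixFn_mem_FP (fanoutFn_mem_FP (comp_mem_FP takeFn_mem_FP (fanoutFn_mem_FP h1 afterZeroFn_mem_FP))
    (fanoutFn_mem_FP (comp_mem_FP takeFn_mem_FP (fanoutFn_mem_FP h2 r3)) (fanoutFn_mem_FP (comp_mem_FP takeFn_mem_FP (fanoutFn_mem_FP onesPrefixFn_mem_FP r4))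
      (fanoutFn_mem_FP (comp_mem_FP takeFn_mem_FP (fanoutFn_mem_FP h3 r5)) (comp_mem_FP onesPrefixFn_mem_FP r6)))))

variable {L : ℕ} {x : List Bool} (g ixc tac : ℕ → Bool) {k : ℕ}

/-- **`parseW` on `wordW`.** [cite: Regev2004, Lemma 3.12 (proof, p. 14)] -/
theorem parseW_wordW (hx : x.length = L) (hk : k ≤ rmax P L) :
    parseW P.sizes (wordW P L x g ixc tac k) = boolPair (ones L) (boolPair (List.ofFn fun t : Fin (kap P L) => ixc t)
      (boolPair (List.ofFn fun t : Fin (sig L) => tac t) (boolPair x (boolPair (List.ofFn fun t : Fin (gam P L) => g t) (ones k))))) := by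
  set A := List.ofFn fun t : Fin (kap P L) => ixc t with hA
  set B := List.ofFn fun t : Fin (sig L) => tac t with hB
  set G := List.ofFn fun t : Fin (gam P L) => g t with hG
  set T := List.replicate (zet P L - k - 1) false with hT
  have hw := wordW_shape (P := P) x g ixc tac k hx hk
  rw [← hA, ← hB, ← hG, ← hT] at hw
  have hAl : A.length = kap P L := by simp [hA]
  have hBl : B.length = sig L := by simp [hB]
  have hGl : G.length = gam P L := by simp [hG]
  have hU : onesPrefixFn (wordW P L x g ixc tac k) = ones L := by rw [hw, onesPrefixFn_ones_append]
  have hR1 : afterZeroFn (wordW P L x g ixc tac k) = A ++ (ones L ++ false :: (B ++ (x ++ (G ++ (ones k ++ false :: T))))) := by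
    rw [hw, afterZeroFn_ones_append]
  have hkap : kapUF P.sizes (wordW P L x g ixc tac k) = ones (kap P L) := by
    simp [kapUF, hU, ones]
  have hsig : sigUF (wordW P L x g ixc tac k) = ones (sig L) := by
    simp [sigUF, hU, ones]
  have hgam : gamUF P.sizes (wordW P L x g ixc tac k) = ones (gam P L) := by
    simp [gamUF, hU, ones]
  have hR2 : rest2F P.sizes (wordW P L x g ixc tac k) = ones L ++ false :: (B ++ (x ++ (G ++ (ones k ++ false :: T)))) := by
    simp only [rest2F, Function.comp_apply, fanoutFn_apply, hkap, hR1, dropFn_boolPair]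
    rw [show (ones (kap P L)).length = A.length by simp [ones, hAl], List.drop_left]
  have hR3 : rest3F P.sizes (wordW P L x g ixc tac k) = B ++ (x ++ (G ++ (ones k ++ false :: T))) := by
    simp only [rest3F, Function.comp_apply, hR2, afterZeroFn_ones_append]
  have hR4 : rest4F P.sizes (wordW P L x g ixc tac k) = x ++ (G ++ (ones k ++ false :: T)) := by
    simp only [rest4F, Function.comp_apply, fanoutFn_apply, hsig, hR3, dropFn_boolPair]
    rw [show (ones (sig L)).length = B.length by simp [ones, hBl], List.drop_left]
  have hR5 : rest5F P.sizes (wordW P L x g ixc tac k) = G ++ (ones k ++ false :: T) := by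
    simp only [rest5F, Function.comp_apply, fanoutFn_apply, hU, hR4, dropFn_boolPair]
    rw [show (ones L).length = x.length by simp [ones, hx], List.drop_left]
  have hR6 : rest6F P.sizes (wordW P L x g ixc tac k) = ones k ++ false :: T := by
    simp only [rest6F, Function.comp_apply, fanoutFn_apply, hgam, hR5, dropFn_boolPair]
    rw [show (ones (gam P L)).length = G.length by simp [ones, hGl], List.drop_left]
  simp only [parseW, fanoutFn_apply, Function.comp_apply, hU, hkap, hsig, hgam, hR1, hR3, hR4, hR5, hR6, takeFn_boolPair,
    onesPrefixFn_ones_append]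
  rw [show (ones (kap P L)).length = A.length by simp [ones, hAl], List.take_left,
    show (ones (sig L)).length = B.length by simp [ones, hBl], List.take_left,
    show (ones L).length = x.length by simp [ones, hx], List.take_left,
    show (ones (gam P L)).length = G.length by simp [ones, hGl], List.take_left]

end ParseW

/-! ### Reading bits at a fixed stride -/

section Stride

variable (A : ℕ)

/-- The piece of the stride fold: on `⟨res, 1^j⟩`, the bit of `res` at `A j + c`. [folklore] -/
def strPiece (c : ℕ) : List Bool → List Bool :=
  bitAtFn ∘ fanoutFn (polyFn (C A * X + C c) ∘ sndF) fstF

/-- **The bits at the positions `A j + c`, `j < |res|`** (pieces past the end are empty). [folklore] -/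
def strideF (c : ℕ) : List Bool → List Bool :=
  sndPow 2 ∘ foldLoop appF (strPiece A c) X ∘ fanoutFn (fun w => w) (fanoutFn lenBinF (fun _ => boolPair [] []))

variable {A}

/-- Growth of the piece: at most one bit. [folklore] -/
theorem length_strPiece_le (c : ℕ) (w : List Bool) : (strPiece A c w).length ≤ 1 * ((fstF w).length + 1) := by
  simp only [strPiece, Function.comp_apply, fanoutFn_apply, bitAtFn_boolPair, List.length_take]
  omega

/-- `strideF c ∈ FP`. [cite: AroraBarak2009, §1.3 (bounded loops)] -/
theorem strideF_mem_FP (c : ℕ) : strideF A c ∈ FP := by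
  have hp : strPiece A c ∈ FP := comp_mem_FP bitAtFn_mem_FP (fanoutFn_mem_FP (comp_mem_FP (polyFn_mem_FP _) sndF_mem_FP) fstF_mem_FP)
  exact comp_mem_FP (sndPow_mem_FP 2) (comp_mem_FP (foldLoop_mem_FP appF_mem_FP length_appF_le hp (length_strPiece_le c) X)
    (fanoutFn_mem_FP (PolyTimeComputable.id _) (fanoutFn_mem_FP lenBinF_mem_FP (const_mem_FP _))))

/-- The piece on `⟨res, 1^j⟩`. [folklore] -/
theorem strPiece_apply (c : ℕ) (res : List Bool) (j : ℕ) :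
    strPiece A c (boolPair res (ones j)) = (res.drop (A * j + c)).take 1 := by
  simp [strPiece, fanoutFn_apply, ones]

/-- **Value of `strideF`**: the concatenation of the one-bit windows at `A j + c`, `j < |res|`. [folklore] -/
theorem strideF_apply (c : ℕ) (res : List Bool) :
    strideF A c res = ccat (fun j => (res.drop (A * j + c)).take 1) res.length := by
  have h0 : fanoutFn (fun w => w) (fanoutFn lenBinF (fun _ => boolPair [] [])) res =
      boolPair res (boolPair (encodeNat res.length) (boolPair (ones 0) [])) := by
    simp [fanoutFn_apply, ones]
  rw [strideF, Function.comp_apply, Function.comp_apply, h0, foldLoop_apply appF (strPiece A c) (by simp) 0 [],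
    sndPow_succ_boolPair, sndPow_succ_boolPair, sndPow_zero_boolPair, foldAcc_appF, List.nil_append]
  exact ccat_congr fun j _ => by rw [Nat.zero_add, strPiece_apply]

/-- A `ccat` of one-bit windows inside the string is the `List.ofFn` of those bits. [folklore] -/
theorem ccat_take_one_eq_ofFn (res : List Bool) (pos : ℕ → ℕ) {m : ℕ} (h : ∀ j, j < m → pos j < res.length) :
    ccat (fun j => (res.drop (pos j)).take 1) m = List.ofFn fun j : Fin m => res[pos j]'(h j j.isLt) := by
  induction m with
  | zero => rfl
  | succ m ih =>
    rw [ccat_succ, ih (fun j hj => h j (by omega)), List.ofFn_succ', List.concat_eq_append]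
    congr 1
    rw [List.take_one_drop_eq_of_lt_length (h m (by omega))]
    rfl

/-- Windows past the end contribute nothing. [folklore] -/
theorem ccat_take_one_of_le (res : List Bool) (pos : ℕ → ℕ) {m m' : ℕ} (hmm : m ≤ m') (hmono : ∀ j, m ≤ j → res.length ≤ pos j) :
    ccat (fun j => (res.drop (pos j)).take 1) m' = ccat (fun j => (res.drop (pos j)).take 1) m := by
  induction m' with
  | zero => rw [Nat.le_zero.1 hmm]
  | succ m' ih =>
    rcases Nat.eq_or_lt_of_le hmm with rfl | hlt
    · rfl
    · rw [ccat_succ, ih (by omega), List.drop_eq_nil_of_le (hmono m' (by omega)), List.take_nil, List.append_nil]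

end Stride

/-! ### The output word of `W`, read back from its result wires -/

section OutWord

variable (M : TM2ComputableAux Bool Bool)

/-- **The output word of a garbage-free block from its result wires**: the `true`-code wires give
the bits, the emptiness wires give the length. [cite: Bennett1973, §2 (the copied result)] -/
def outWordF : List Bool → List Bool :=
  takeFn ∘ fanoutFn (CWrap.liveLenFn ∘ strideF (A₁ M) (eA M none)) (strideF (A₁ M) (eA M (CWrap.symTrue M)))

variable {M}

/-- `outWordF ∈ FP`. [cite: AroraBarak2009, §1.3] -/
theorem outWordF_mem_FP : outWordF M ∈ FP :=
  comp_mem_FP takeFn_mem_FP (fanoutFn_mem_FP (comp_mem_FP CWrap.liveLenFn_mem_FP (strideF_mem_FP _)) (strideF_mem_FP _))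

variable {L : ℕ}

/-- The result wires of `W` on a word `u` of length `n0W L` with output `y`. [folklore] -/
def resBits (P : Params) (L : ℕ) (y : List Bool) : List Bool :=
  List.ofFn fun t : Fin (copyW P L) => readOut P.eW P.MW (n0W P L) y (NNW P L + t)

/-- A stride of the result wires is the corresponding read-out profile. [folklore] -/
theorem strideF_resBits (y : List Bool) (a : OSym P.MW) :
    strideF (A₁ P.MW) (eA P.MW a) (resBits P L y) = List.ofFn fun j : Fin (JJ P.eW P.MW (n0W P L)) => outBit P.MW y j a := by
  have hlen : (resBits P L y).length = copyW P L := by simp [resBits]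
  have hA := one_le_A₁ (M := P.MW)
  have hcw : copyW P L = JJ P.eW P.MW (n0W P L) * A₁ P.MW := rfl
  have hpos : ∀ j, j < JJ P.eW P.MW (n0W P L) → A₁ P.MW * j + eA P.MW a < (resBits P L y).length := fun j hj => by
    rw [hlen, hcw]
    have h1 : (eA P.MW a : ℕ) < A₁ P.MW := (eA P.MW a).isLt
    have h2 : A₁ P.MW * (j + 1) ≤ JJ P.eW P.MW (n0W P L) * A₁ P.MW := by rw [mul_comm]; exact Nat.mul_le_mul_right _ hj
    rw [Nat.mul_succ] at h2; omega
  rw [strideF_apply, ccat_take_one_of_le _ _ (m := JJ P.eW P.MW (n0W P L)) (by rw [hlen, hcw]; exact Nat.le_mul_of_pos_right _ hA)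
    (fun j hj => by
      rw [hlen, hcw]
      calc JJ P.eW P.MW (n0W P L) * A₁ P.MW ≤ j * A₁ P.MW := Nat.mul_le_mul_right _ hj
        _ = A₁ P.MW * j := mul_comm _ _
        _ ≤ A₁ P.MW * j + eA P.MW a := Nat.le_add_right _ _),
    ccat_take_one_eq_ofFn _ _ hpos]
  congr 1
  funext j
  have hj := hpos j j.isLt
  rw [hlen] at hj
  simp only [resBits, List.getElem_ofFn]
  have e : NNW P L + (A₁ P.MW * j + eA P.MW a) = resW P.eW P.MW (n0W P L) j a := by unfold resW NNW; ring
  rw [e, readOut_resW j.isLt]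

variable {x : List Bool} (g ixc tac : ℕ → Bool) (k : ℕ)

/-- **`outWordF` on the result wires of `W` returns the output word of `W`.** [cite: Bennett1973, §2] -/
theorem outWordF_resBits :
    outWordF P.MW (resBits P L (P.fW (wordW P L x g ixc tac k))) = P.fW (wordW P L x g ixc tac k) := by
  have hlenW : (wordW P L x g ixc tac k).length = n0W P L := length_wordW x g ixc tac k
  have hM := P.hMW (wordW P L x g ixc tac k)
  rw [hlenW] at hM
  have hJJ := (length_lt_JJ_of_outputsWithin hlenW hM).1
  set y := P.fW (wordW P L x g ixc tac k) with hy
  have hnone : (List.ofFn fun j : Fin (JJ P.eW P.MW (n0W P L)) => outBit P.MW y j none) =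
      List.ofFn fun j : Fin (JJ P.eW P.MW (n0W P L)) => decide (y.length ≤ (j : ℕ)) := by
    congr 1; funext j; exact CWrap.outBit_none_eq hlenW hM j
  have hlive : CWrap.liveLen (List.ofFn fun j : Fin (JJ P.eW P.MW (n0W P L)) => decide (y.length ≤ (j : ℕ))) = y.length := by
    unfold CWrap.liveLen
    rw [List.findIdx_eq (by simp; exact hJJ)]
    refine ⟨by simp, fun j hj => by simp; omega⟩
  simp only [outWordF, Function.comp_apply, fanoutFn_apply, strideF_resBits, CWrap.liveLenFn_apply, hnone, hlive, takeFn_boolPair]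
  rw [show (ones y.length).length = y.length by simp [ones]]
  apply List.ext_getElem
  · simp; omega
  · intro i h1 h2
    rw [List.getElem_take, List.getElem_ofFn]
    exact CWrap.outBit_symTrue_eq hlenW hM h2

end OutWord

/-! ### Parsing `wordV` -/

section ParseV

variable (S) (e : ℕ) (M : TM2ComputableAux Bool Bool)

/-- `x · g · Z · 0^{NNW−n0W} · res` (after `U` and `ta`). [folklore] -/
def vrest2F : List Bool → List Bool := dropFn ∘ fanoutFn sigUF afterZeroFn
/-- `g · Z · 0^{NNW−n0W} · res`. [folklore] -/
def vrest3F : List Bool → List Bool := dropFn ∘ fanoutFn onesPrefixFn vrest2F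
/-- `Z · 0^{NNW−n0W} · res`. [folklore] -/
def vrest4F : List Bool → List Bool := dropFn ∘ fanoutFn (gamUF S) vrest3F
/-- `res`. [folklore] -/
def vresF : List Bool → List Bool := dropFn ∘ fanoutFn (polyFn (padVPoly S e M) ∘ onesPrefixFn) (vrest4F S)

/-- **The parser of `wordV`**: `⟨1^L, ⟨ta, ⟨x, ⟨g, ⟨1^k, output word of W⟩⟩⟩⟩⟩`.
[cite: Bennett1973, §2 (the erasing stage sees the kept data and the copied result)] -/
def parseV : List Bool → List Bool :=
  fanoutFn onesPrefixFn (fanoutFn (takeFn ∘ fanoutFn sigUF afterZeroFn) (fanoutFn (takeFn ∘ fanoutFn onesPrefixFn vrest2F)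
    (fanoutFn (takeFn ∘ fanoutFn (gamUF S) vrest3F) (fanoutFn (onesPrefixFn ∘ vrest4F S) (outWordF M ∘ vresF S e M)))))

variable {S e M}

/-- `parseV ∈ FP`. [cite: AroraBarak2009, §1.3] -/
theorem parseV_mem_FP : parseV S e M ∈ FP := by
  have h2 : sigUF ∈ FP := comp_mem_FP (polyFn_mem_FP _) onesPrefixFn_mem_FP
  have h3 : gamUF S ∈ FP := comp_mem_FP (polyFn_mem_FP _) onesPrefixFn_mem_FP
  have r2 : vrest2F ∈ FP := comp_mem_FP dropFn_mem_FP (fanoutFn_mem_FP h2 afterZeroFn_mem_FP)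
  have r3 : vrest3F ∈ FP := comp_mem_FP dropFn_mem_FP (fanoutFn_mem_FP onesPrefixFn_mem_FP r2)
  have r4 : vrest4F S ∈ FP := comp_mem_FP dropFn_mem_FP (fanoutFn_mem_FP h3 r3)
  have r5 : vresF S e M ∈ FP := comp_mem_FP dropFn_mem_FP (fanoutFn_mem_FP (comp_mem_FP (polyFn_mem_FP _) onesPrefixFn_mem_FP) r4)
  exact fanoutFn_mem_FP onesPrefixFn_mem_FP (fanoutFn_mem_FP (comp_mem_FP takeFn_mem_FP (fanoutFn_mem_FP h2 afterZeroFn_mem_FP))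
    (fanoutFn_mem_FP (comp_mem_FP takeFn_mem_FP (fanoutFn_mem_FP onesPrefixFn_mem_FP r2)) (fanoutFn_mem_FP (comp_mem_FP takeFn_mem_FP (fanoutFn_mem_FP h3 r3))
      (fanoutFn_mem_FP (comp_mem_FP onesPrefixFn_mem_FP r4) (comp_mem_FP outWordF_mem_FP r5)))))

variable {L : ℕ} {x : List Bool} (g ixc tac : ℕ → Bool) {k : ℕ}

/-- **`parseV` on `wordV`.** [cite: Bennett1973, §2] -/
theorem parseV_wordV (hx : x.length = L) (hk : k ≤ rmax P L) :
    parseV P.sizes P.eW P.MW (wordV P L x g ixc tac k) = boolPair (ones L) (boolPair (List.ofFn fun t : Fin (sig L) => tac t)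
      (boolPair x (boolPair (List.ofFn fun t : Fin (gam P L) => g t) (boolPair (ones k) (P.fW (wordW P L x g ixc tac k)))))) := by
  set B := List.ofFn fun t : Fin (sig L) => tac t with hB
  set G := List.ofFn fun t : Fin (gam P L) => g t with hG
  set T := List.replicate (zet P L - k - 1 + (NNW P L - n0W P L)) false with hT
  set R := resBits P L (P.fW (wordW P L x g ixc tac k)) with hR
  have hw := wordV_shape (P := P) x g ixc tac k hx hk
  rw [← hB, ← hG, ← hT, show (List.ofFn fun t : Fin (copyW P L) =>
    readOut P.eW P.MW (n0W P L) (P.fW (wordW P L x g ixc tac k)) (NNW P L + t)) = R from rfl] at hw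
  have hBl : B.length = sig L := by simp [hB]
  have hGl : G.length = gam P L := by simp [hG]
  have hTl : T.length = zet P L - k - 1 + (NNW P L - n0W P L) := by simp [hT]
  have hU : onesPrefixFn (wordV P L x g ixc tac k) = ones L := by rw [hw, onesPrefixFn_ones_append]
  have hR1 : afterZeroFn (wordV P L x g ixc tac k) = B ++ (x ++ (G ++ (ones k ++ false :: (T ++ R)))) := by
    rw [hw, afterZeroFn_ones_append]
  have hsig : sigUF (wordV P L x g ixc tac k) = ones (sig L) := by simp [sigUF, hU, ones]
  have hgam : gamUF P.sizes (wordV P L x g ixc tac k) = ones (gam P L) := by simp [gamUF, hU, ones]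
  have hpad : polyFn (padVPoly P.sizes P.eW P.MW) (onesPrefixFn (wordV P L x g ixc tac k)) = ones (zet P L + (NNW P L - n0W P L)) := by
    rw [hU, polyFn_apply, show (ones L).length = L by simp [ones], eval_padVPoly]
  have hR2 : vrest2F (wordV P L x g ixc tac k) = x ++ (G ++ (ones k ++ false :: (T ++ R))) := by
    simp only [vrest2F, Function.comp_apply, fanoutFn_apply, hsig, hR1, dropFn_boolPair]
    rw [show (ones (sig L)).length = B.length by simp [ones, hBl], List.drop_left]
  have hR3 : vrest3F (wordV P L x g ixc tac k) = G ++ (ones k ++ false :: (T ++ R)) := by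
    simp only [vrest3F, Function.comp_apply, fanoutFn_apply, hU, hR2, dropFn_boolPair]
    rw [show (ones L).length = x.length by simp [ones, hx], List.drop_left]
  have hR4 : vrest4F P.sizes (wordV P L x g ixc tac k) = ones k ++ false :: (T ++ R) := by
    simp only [vrest4F, Function.comp_apply, fanoutFn_apply, hgam, hR3, dropFn_boolPair]
    rw [show (ones (gam P L)).length = G.length by simp [ones, hGl], List.drop_left]
  have hR5 : vresF P.sizes P.eW P.MW (wordV P L x g ixc tac k) = R := by
    simp only [vresF, Function.comp_apply, fanoutFn_apply, hR4, dropFn_boolPair, hpad]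
    have e : ones k ++ false :: (T ++ R) = (ones k ++ false :: T) ++ R := by simp [List.append_assoc]
    rw [e, show (ones (zet P L + (NNW P L - n0W P L))).length = (ones k ++ false :: T).length by
      simp [ones, hTl]; unfold zet; omega, List.drop_left]
  simp only [parseV, fanoutFn_apply, Function.comp_apply, hU, hsig, hgam, hR1, hR2, hR3, hR4, hR5, takeFn_boolPair,
    onesPrefixFn_ones_append, hR, outWordF_resBits g ixc tac k]
  rw [show (ones (sig L)).length = B.length by simp [ones, hBl], List.take_left,
    show (ones L).length = x.length by simp [ones, hx], List.take_left,
    show (ones (gam P L)).length = G.length by simp [ones, hGl], List.take_left]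

end ParseV

end RegevRoutine

end Literature.Algebra.EuclideanLattices

end
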